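import Literature.Geometry.Symplectic.CompatibleAlmostComplexStructureExists
import Literature.Geometry.Symplectic.AlmostComplexTangentBundle
import Mathlib.Analysis.InnerProductSpace.Adjoint
import HarnessLib

/-!
# The symplectic complement of a symplectic subspace and the adapted splitting

Linear algebra of McDuff–Salamon, *Introduction to Symplectic Topology* (3rd ed. 2017), §2.1
(2.1.1) and Lemma 2.1.1 (the symplectic complement `W^ω`, `V = W ⊕ W^ω` for `W` symplectic),
Prop. 2.5.6 / Prop. 2.6.4 (the compatible complex structure `J_{g,ω}` of a metric and a
symplectic form) and Thm. 2.6.3 (two `ω`-tame complex structures give isomorphic complex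
bundles), in the fibrewise form needed for the splitting `T_Σ X = TΣ ⊕ ν_Σ` of Ex. 4.4.5 and
§3.4 p. 114 ("the normal bundle `ν_Q` may be identified with the complementary symplectic bundle
`TQ^ω` … a symplectic vector bundle"). Everything is on fixed finite-dimensional real inner product
spaces `V ⊇ d(W)` (the model fibres), for a `2`-form `a` on `V`, an injection `d : W → V` with
`d^* a` nondegenerate, an `a`-tame complex structure `J` on `V` and a `d^* a`-tame `j` on `W`:

* `pullbackOp a d = d† Ω_a d` (`⟪pullbackOp u, u'⟫ = a(d u, d u')`), invertible;
  `leftInv a d = (d† Ω_a d)⁻¹ d† Ω_a`, the symplectic left inverse of `d` (`leftInv (d u) = u`);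
  `projF = d ∘ leftInv`, `projG = 1 - projF` — the projections of `V = F ⊕ G`, `F = d(W)`,
  `G = F^a` its symplectic complement (`form_d_projG : a(d u, projG v) = 0`);
* `blockMetric a d g` — the metric `g(π_F ·, π_F ·) + g(π_G ·, π_G ·)` built from the metric
  `tameMetric a J = a(·, J ·)` (symmetrised), for which `F ⟂ G`;
* `adaptedJ a d J := J_{g̃, a}` (`polarJOfMetric`) — an `a`-compatible complex structure on `V`
  PRESERVING `F` and `G` (`adaptedJ_projF`, by the `GL`-equivariance `polarJOfMetric_conj` applied to
  the reflection `π_F − π_G`);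
* `tangentJ a d J := leftInv ∘ J̃ ∘ d` — the induced `d^*a`-tame complex structure on `W`;
* `splitF a d J j := ½(1 − j j_W) ∘ leftInv ∘ ½(1 − J̃ J)` and `splitG a d J := π_G ∘ ½(1 − J̃ J)` —
  the two components of the splitting map `(V, J) → (W, j) × (G, J̃)`, complex-linear
  (`splitF_J`, `splitG_J`) and jointly injective (`eq_zero_of_splitF_eq_zero_of_splitG_eq_zero`);
* `lineCoord a d J n : V →L[ℝ] ℂ` — the complex coordinate of `G` in the frame `n`, `J̃ n` when
  `dim V = dim W + 2` (`G` a complex line): `lineCoord n n = 1`, `lineCoord n (J̃ v) = i · lineCoord n v`,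
  the frame expansion `re • n + im • J̃ n = π_G v` and the cocycle
  `lineCoord n' v = lineCoord n' n * lineCoord n v`.

Pure linear algebra; no `sorry`, no new definitions of notions the tree has (the compatible
`J_{g,ω}` is the tree's `polarJOfMetric`, the intertwiner `½(1 − J₁ J₀)` its `jInterp`).

## References

* [McDuffSalamon2017] D. McDuff, D. Salamon, Introduction to Symplectic Topology, 3rd ed., OUP
  2017, §2.1 (2.1.1), Lemma 2.1.1; Prop. 2.5.6; §2.6 Thm. 2.6.3, Prop. 2.6.4; §3.4 p. 114;
  Ex. 4.4.5.
-/

noncomputable section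

open scoped RealInnerProductSpace ComplexConjugate
open Function Module Complex Literature.Analysis.OperatorTheory

namespace Literature.Geometry.Symplectic

namespace SymplecticSplitting

variable {V W : Type*} [NormedAddCommGroup V] [InnerProductSpace ℝ V] [NormedAddCommGroup W]
  [InnerProductSpace ℝ W]

/-! ### Two-forms: elementary rewriting -/

section TwoForm

variable (a : V [⋀^Fin 2]→L[ℝ] ℝ)

/-- `a(x + y, w) = a(x, w) + a(y, w)`. [folklore] -/
theorem form_add_left (x y w : V) : a ![x + y, w] = a ![x, w] + a ![y, w] := by
  rw [← bilinOfAlt_apply, map_add]; rfl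

/-- `a(x − y, w) = a(x, w) − a(y, w)`. [folklore] -/
theorem form_sub_left (x y w : V) : a ![x - y, w] = a ![x, w] - a ![y, w] := by
  rw [← bilinOfAlt_apply, map_sub]; rfl

/-- `a(c x, w) = c a(x, w)`. [folklore] -/
theorem form_smul_left (c : ℝ) (x w : V) : a ![c • x, w] = c * a ![x, w] := by
  rw [← bilinOfAlt_apply, map_smul]; rfl

/-- `a(v, x + y) = a(v, x) + a(v, y)`. [folklore] -/
theorem form_add_right (v x y : V) : a ![v, x + y] = a ![v, x] + a ![v, y] := by
  rw [← bilinOfAlt_apply, map_add]; rfl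

/-- `a(v, x − y) = a(v, x) − a(v, y)`. [folklore] -/
theorem form_sub_right (v x y : V) : a ![v, x - y] = a ![v, x] - a ![v, y] := by
  rw [← bilinOfAlt_apply, map_sub]; rfl

/-- `a(v, c x) = c a(v, x)`. [folklore] -/
theorem form_smul_right (c : ℝ) (v x : V) : a ![v, c • x] = c * a ![v, x] := by
  rw [← bilinOfAlt_apply, map_smul]; rfl

/-- `a(v, −x) = −a(v, x)`. [folklore] -/
theorem form_neg_right (v x : V) : a ![v, -x] = -a ![v, x] := by
  rw [← bilinOfAlt_apply, map_neg]; rfl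

/-- `a(v, 0) = 0`. [folklore] -/
theorem form_zero_right (v : V) : a ![v, (0 : V)] = 0 := by
  rw [← bilinOfAlt_apply, map_zero]

/-- `a(0, v) = 0`. [folklore] -/
theorem form_zero_left (v : V) : a ![(0 : V), v] = 0 := by
  rw [← bilinOfAlt_apply, map_zero]; rfl

/-- **Antisymmetry**: `a(v, w) = −a(w, v)`. [folklore] -/
theorem form_swap (v w : V) : a ![v, w] = -a ![w, v] := by
  have h := a.map_swap ![w, v] (i := 0) (j := 1) (by decide)
  have h1 : (![w, v] : Fin 2 → V) ∘ Equiv.swap 0 1 = ![v, w] := by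
    ext i; fin_cases i <;> rfl
  rw [← h1]
  exact h

/-- `a(v, v) = 0`. [folklore] -/
theorem form_self (v : V) : a ![v, v] = 0 := by
  have h := form_swap a v v
  linarith

end TwoForm

/-! ### Bilinear helpers: precomposition, and the (symmetrised) metric of a tame `J` -/

section Bilinear

/-- Precomposition of a continuous bilinear form with an operator in both slots:
`bilinPrecomp B T v w = B (T v) (T w)`. [folklore] -/
def bilinPrecomp (B : V →L[ℝ] V →L[ℝ] ℝ) (T : V →L[ℝ] V) : V →L[ℝ] V →L[ℝ] ℝ :=
  ((B.comp T).flip.comp T).flip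

/-- Unfolding `bilinPrecomp`. [folklore] -/
@[simp]
theorem bilinPrecomp_apply (B : V →L[ℝ] V →L[ℝ] ℝ) (T : V →L[ℝ] V) (v w : V) :
    bilinPrecomp B T v w = B (T v) (T w) := rfl

/-- **The metric of an `a`-tame `J`, symmetrised**: `g_J(v, w) = a(v, J w) + a(w, J v)`
(McDuff–Salamon 2017, §2.6: `g_J := ω(·, J·)` is an inner product for compatible `J`; for a
merely tame `J` its symmetrisation is). [cite: McDuffSalamon2017, §2.6 (Hermitian structure)] -/
def tameMetric (a : V [⋀^Fin 2]→L[ℝ] ℝ) (J : V →L[ℝ] V) : V →L[ℝ] V →L[ℝ] ℝ :=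
  ((bilinOfAlt a).flip.comp J).flip + (bilinOfAlt a).flip.comp J

/-- Unfolding `tameMetric`. [folklore] -/
@[simp]
theorem tameMetric_apply (a : V [⋀^Fin 2]→L[ℝ] ℝ) (J : V →L[ℝ] V) (v w : V) :
    tameMetric a J v w = a ![v, J w] + a ![w, J v] := rfl

/-- `g_J` is symmetric. [folklore] -/
theorem tameMetric_symm (a : V [⋀^Fin 2]→L[ℝ] ℝ) (J : V →L[ℝ] V) (v w : V) :
    tameMetric a J v w = tameMetric a J w v := by
  rw [tameMetric_apply, tameMetric_apply, add_comm]

/-- `g_J(v, v) = 2 a(v, J v) > 0` for `v ≠ 0` and `J` tame. [cite: McDuffSalamon2017, §2.6 (Hermitian structure)] -/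
theorem tameMetric_self_pos (a : V [⋀^Fin 2]→L[ℝ] ℝ) {J : V →L[ℝ] V}
    (hJt : ∀ v : V, v ≠ 0 → 0 < a ![v, J v]) {v : V} (hv : v ≠ 0) : 0 < tameMetric a J v v := by
  rw [tameMetric_apply]
  have := hJt v hv
  linarith

end Bilinear

variable [FiniteDimensional ℝ V] [CompleteSpace V] [FiniteDimensional ℝ W] [CompleteSpace W]

/-! ### The Gram operator `Ω_a` of the form and the pulled-back operator `d† Ω_a d` -/

section Projections

variable (a : V [⋀^Fin 2]→L[ℝ] ℝ) (d : W →L[ℝ] V)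

/-- The Gram operator `Ω_a` of the `2`-form `a`: `⟪Ω_a v, w⟫ = a(v, w)`. [folklore] -/
abbrev formOp : V →L[ℝ] V := gram (bilinOfAlt a)

omit [CompleteSpace V] in
/-- `⟪Ω_a v, w⟫ = a(v, w)`. [folklore] -/
theorem inner_formOp (v w : V) : ⟪formOp a v, w⟫ = a ![v, w] := by
  rw [inner_gram_left, bilinOfAlt_apply]

/-- **`d† Ω_a d`**, the Gram operator of the pulled-back form `d^* a` on `W`:
`⟪pullbackOp u, u'⟫ = a(d u, d u')`. [cite: McDuffSalamon2017, §2.1 Lemma 2.1.1 (the map `ι_ω`)] -/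
def pullbackOp : W →L[ℝ] W := (ContinuousLinearMap.adjoint d).comp ((formOp a).comp d)

omit [FiniteDimensional ℝ W] in
/-- `⟪d† Ω_a d u, u'⟫ = a(d u, d u')`. [folklore] -/
theorem inner_pullbackOp (u u' : W) : ⟪pullbackOp a d u, u'⟫ = a ![d u, d u'] := by
  rw [pullbackOp, ContinuousLinearMap.comp_apply, ContinuousLinearMap.adjoint_inner_left,
    ContinuousLinearMap.comp_apply, inner_formOp]

variable {a d}

omit [FiniteDimensional ℝ V] [CompleteSpace V] [FiniteDimensional ℝ W] [CompleteSpace W] in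
/-- If `d^* a` is nondegenerate then `d` is injective. [folklore] -/
theorem d_injective (hnd : ∀ u : W, u ≠ 0 → ∃ u' : W, a ![d u, d u'] ≠ 0) : Injective d := by
  refine (injective_iff_map_eq_zero _).2 fun u hu ↦ by_contra fun hne ↦ ?_
  obtain ⟨u', hu'⟩ := hnd u hne
  exact hu' (by rw [hu, form_zero_left])

omit [FiniteDimensional ℝ V] [CompleteSpace V] [FiniteDimensional ℝ W] [CompleteSpace W] in
/-- `d u ≠ 0` for `u ≠ 0` when `d^* a` is nondegenerate. [folklore] -/
theorem d_ne_zero (hnd : ∀ u : W, u ≠ 0 → ∃ u' : W, a ![d u, d u'] ≠ 0) {u : W} (hu : u ≠ 0) :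
    d u ≠ 0 := fun h ↦ hu (d_injective hnd (by rw [h, map_zero]))

omit [FiniteDimensional ℝ W] in
/-- If `d^* a` is nondegenerate then `d† Ω_a d` is injective. [cite: McDuffSalamon2017, §2.1 Lemma 2.1.1] -/
theorem pullbackOp_injective (hnd : ∀ u : W, u ≠ 0 → ∃ u' : W, a ![d u, d u'] ≠ 0) :
    Injective (pullbackOp a d) := by
  refine (injective_iff_map_eq_zero _).2 fun u hu ↦ by_contra fun hne ↦ ?_
  obtain ⟨u', hu'⟩ := hnd u hne
  exact hu' (by rw [← inner_pullbackOp, hu, inner_zero_left])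

/-- `d† Ω_a d` as a linear automorphism of `W` (finite dimension). [folklore] -/
def pullbackEquiv (hnd : ∀ u : W, u ≠ 0 → ∃ u' : W, a ![d u, d u'] ≠ 0) : W ≃L[ℝ] W :=
  (LinearEquiv.ofBijective (pullbackOp a d).toLinearMap
    ⟨pullbackOp_injective hnd, LinearMap.surjective_of_injective (pullbackOp_injective hnd)⟩)
    |>.toContinuousLinearEquiv

/-- Unfolding `pullbackEquiv`. [folklore] -/
theorem pullbackEquiv_apply (hnd : ∀ u : W, u ≠ 0 → ∃ u' : W, a ![d u, d u'] ≠ 0) (u : W) :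
    pullbackEquiv hnd u = pullbackOp a d u := rfl

/-- `pullbackEquiv` is `pullbackOp` as a map. [folklore] -/
theorem coe_pullbackEquiv (hnd : ∀ u : W, u ≠ 0 → ∃ u' : W, a ![d u, d u'] ≠ 0) :
    (pullbackEquiv hnd : W →L[ℝ] W) = pullbackOp a d := by
  ext u; rfl

/-- `d† Ω_a d` is invertible. [cite: McDuffSalamon2017, §2.1 Lemma 2.1.1] -/
theorem isInvertible_pullbackOp (hnd : ∀ u : W, u ≠ 0 → ∃ u' : W, a ![d u, d u'] ≠ 0) :
    (pullbackOp a d).IsInvertible :=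
  ⟨pullbackEquiv hnd, coe_pullbackEquiv hnd⟩

/-- The inverse of `d† Ω_a d` is the inverse equivalence. [folklore] -/
theorem inverse_pullbackOp (hnd : ∀ u : W, u ≠ 0 → ∃ u' : W, a ![d u, d u'] ≠ 0) :
    (pullbackOp a d).inverse = ((pullbackEquiv hnd).symm : W →L[ℝ] W) := by
  rw [← coe_pullbackEquiv hnd, ContinuousLinearMap.inverse_equiv]

/-- `(d† Ω_a d)⁻¹ (d† Ω_a d u) = u`. [folklore] -/
theorem inverse_pullbackOp_apply_pullbackOp (hnd : ∀ u : W, u ≠ 0 → ∃ u' : W, a ![d u, d u'] ≠ 0)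
    (u : W) : (pullbackOp a d).inverse (pullbackOp a d u) = u := by
  rw [inverse_pullbackOp hnd, ← pullbackEquiv_apply hnd]
  exact (pullbackEquiv hnd).symm_apply_apply u

/-- `d† Ω_a d ((d† Ω_a d)⁻¹ u) = u`. [folklore] -/
theorem pullbackOp_inverse_apply (hnd : ∀ u : W, u ≠ 0 → ∃ u' : W, a ![d u, d u'] ≠ 0) (u : W) :
    pullbackOp a d ((pullbackOp a d).inverse u) = u := by
  rw [inverse_pullbackOp hnd, ← pullbackEquiv_apply hnd]
  exact (pullbackEquiv hnd).apply_symm_apply u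

variable (a d)

/-- **The symplectic left inverse `L = (d† Ω_a d)⁻¹ d† Ω_a` of `d`**: `L (d u) = u`, and `L v` is
the unique `u` with `a(v − d u, d u') = 0` for all `u'`, i.e. `d ∘ L` is the projection onto
`F = d(W)` along the symplectic complement `F^a`. [cite: McDuffSalamon2017, §2.1 (2.1.1), Lemma 2.1.1] -/
def leftInv : V →L[ℝ] W :=
  (pullbackOp a d).inverse.comp ((ContinuousLinearMap.adjoint d).comp (formOp a))

/-- **The projection `π_F = d ∘ L` onto `F = d(W)` along `F^a`.** [cite: McDuffSalamon2017, §2.1 Lemma 2.1.1] -/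
def projF : V →L[ℝ] V := d.comp (leftInv a d)

/-- **The projection `π_G = 1 − π_F` onto the symplectic complement `G = F^a` along `F`.**
[cite: McDuffSalamon2017, §2.1 (2.1.1)] -/
def projG : V →L[ℝ] V := ContinuousLinearMap.id ℝ V - projF a d

omit [FiniteDimensional ℝ W] in
/-- Unfolding `π_F = d ∘ L`. [folklore] -/
theorem projF_apply (v : V) : projF a d v = d (leftInv a d v) := rfl

omit [FiniteDimensional ℝ W] in
/-- Unfolding `π_G = 1 − d ∘ L`. [folklore] -/
theorem projG_apply (v : V) : projG a d v = v - d (leftInv a d v) := rfl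

omit [FiniteDimensional ℝ W] in
/-- `π_F + π_G = 1`. [folklore] -/
theorem projF_add_projG (v : V) : projF a d v + projG a d v = v := by
  rw [projG_apply, projF_apply, add_sub_cancel]

variable {a d}

/-- `(d† Ω_a d) (L v) = d† Ω_a v`. [folklore] -/
theorem pullbackOp_leftInv (hnd : ∀ u : W, u ≠ 0 → ∃ u' : W, a ![d u, d u'] ≠ 0) (v : V) :
    pullbackOp a d (leftInv a d v) = ContinuousLinearMap.adjoint d (formOp a v) := by
  rw [leftInv, ContinuousLinearMap.comp_apply, pullbackOp_inverse_apply hnd]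
  rfl

/-- **`L (d u) = u`.** [folklore] -/
theorem leftInv_d (hnd : ∀ u : W, u ≠ 0 → ∃ u' : W, a ![d u, d u'] ≠ 0) (u : W) :
    leftInv a d (d u) = u := by
  have h : ContinuousLinearMap.adjoint d (formOp a (d u)) = pullbackOp a d u := rfl
  rw [leftInv, ContinuousLinearMap.comp_apply, ContinuousLinearMap.comp_apply, h,
    inverse_pullbackOp_apply_pullbackOp hnd]

/-- **The defining property of `L`: `a(d (L v), d u') = a(v, d u')`.** [cite: McDuffSalamon2017, §2.1 (2.1.1)] -/
theorem form_d_leftInv_d (hnd : ∀ u : W, u ≠ 0 → ∃ u' : W, a ![d u, d u'] ≠ 0) (v : V) (u' : W) :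
    a ![d (leftInv a d v), d u'] = a ![v, d u'] := by
  rw [← inner_pullbackOp, pullbackOp_leftInv hnd, ContinuousLinearMap.adjoint_inner_left, inner_formOp]

/-- `π_F` is the identity on `F = d(W)`. [folklore] -/
theorem projF_d (hnd : ∀ u : W, u ≠ 0 → ∃ u' : W, a ![d u, d u'] ≠ 0) (u : W) :
    projF a d (d u) = d u := by
  rw [projF_apply, leftInv_d hnd]

/-- `π_G` kills `F = d(W)`. [folklore] -/
theorem projG_d (hnd : ∀ u : W, u ≠ 0 → ∃ u' : W, a ![d u, d u'] ≠ 0) (u : W) :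
    projG a d (d u) = 0 := by
  rw [projG_apply, leftInv_d hnd, sub_self]

/-- `L ∘ π_F = L`. [folklore] -/
theorem leftInv_projF (hnd : ∀ u : W, u ≠ 0 → ∃ u' : W, a ![d u, d u'] ≠ 0) (v : V) :
    leftInv a d (projF a d v) = leftInv a d v := by
  rw [projF_apply, leftInv_d hnd]

/-- `L ∘ π_G = 0`: `G ⊆ ker L`. [folklore] -/
theorem leftInv_projG (hnd : ∀ u : W, u ≠ 0 → ∃ u' : W, a ![d u, d u'] ≠ 0) (v : V) :
    leftInv a d (projG a d v) = 0 := by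
  rw [projG_apply, map_sub, leftInv_d hnd, sub_self]

/-- `π_F` is idempotent. [folklore] -/
theorem projF_projF (hnd : ∀ u : W, u ≠ 0 → ∃ u' : W, a ![d u, d u'] ≠ 0) (v : V) :
    projF a d (projF a d v) = projF a d v := by
  rw [projF_apply, projF_apply, leftInv_d hnd]

/-- `π_F π_G = 0`. [folklore] -/
theorem projF_projG (hnd : ∀ u : W, u ≠ 0 → ∃ u' : W, a ![d u, d u'] ≠ 0) (v : V) :
    projF a d (projG a d v) = 0 := by
  rw [projF_apply, leftInv_projG hnd, map_zero]

/-- `π_G π_F = 0`. [folklore] -/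
theorem projG_projF (hnd : ∀ u : W, u ≠ 0 → ∃ u' : W, a ![d u, d u'] ≠ 0) (v : V) :
    projG a d (projF a d v) = 0 := by
  rw [projG_apply, leftInv_projF hnd, ← projF_apply, sub_self]

/-- `π_G` is idempotent. [folklore] -/
theorem projG_projG (hnd : ∀ u : W, u ≠ 0 → ∃ u' : W, a ![d u, d u'] ≠ 0) (v : V) :
    projG a d (projG a d v) = projG a d v := by
  conv_rhs => rw [← projF_add_projG a d (projG a d v), projF_projG hnd, zero_add]

/-- **`G = π_G(V)` is the symplectic complement of `F = d(W)`**: `a(π_G v, d u) = 0`.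
[cite: McDuffSalamon2017, §2.1 (2.1.1)] -/
theorem form_projG_d (hnd : ∀ u : W, u ≠ 0 → ∃ u' : W, a ![d u, d u'] ≠ 0) (v : V) (u : W) :
    a ![projG a d v, d u] = 0 := by
  rw [projG_apply, form_sub_left, form_d_leftInv_d hnd, sub_self]

/-- `a(d u, π_G v) = 0`: `F` and `G` are `a`-orthogonal. [cite: McDuffSalamon2017, §2.1 (2.1.1)] -/
theorem form_d_projG (hnd : ∀ u : W, u ≠ 0 → ∃ u' : W, a ![d u, d u'] ≠ 0) (u : W) (v : V) :
    a ![d u, projG a d v] = 0 := by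
  rw [form_swap, form_projG_d hnd, neg_zero]

/-- `a(π_F v, π_G w) = 0`. [cite: McDuffSalamon2017, §2.1 (2.1.1)] -/
theorem form_projF_projG (hnd : ∀ u : W, u ≠ 0 → ∃ u' : W, a ![d u, d u'] ≠ 0) (v w : V) :
    a ![projF a d v, projG a d w] = 0 :=
  form_d_projG hnd _ _

/-- `a(π_G v, π_F w) = 0`. [cite: McDuffSalamon2017, §2.1 (2.1.1)] -/
theorem form_projG_projF (hnd : ∀ u : W, u ≠ 0 → ∃ u' : W, a ![d u, d u'] ≠ 0) (v w : V) :
    a ![projG a d v, projF a d w] = 0 :=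
  form_projG_d hnd _ _

/-- **`a` is block-diagonal for `V = F ⊕ G`.** [cite: McDuffSalamon2017, §2.1 Lemma 2.1.1] -/
theorem form_eq_blocks (hnd : ∀ u : W, u ≠ 0 → ∃ u' : W, a ![d u, d u'] ≠ 0) (v w : V) :
    a ![v, w] = a ![projF a d v, projF a d w] + a ![projG a d v, projG a d w] := by
  conv_lhs => rw [← projF_add_projG a d v, ← projF_add_projG a d w]
  rw [form_add_left, form_add_right, form_add_right, form_projF_projG hnd, form_projG_projF hnd]
  ring

/-- `a(d u, π_F v) = a(d u, v)`. [folklore] -/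
theorem form_d_projF (hnd : ∀ u : W, u ≠ 0 → ∃ u' : W, a ![d u, d u'] ≠ 0) (u : W) (v : V) :
    a ![d u, projF a d v] = a ![d u, v] := by
  conv_rhs => rw [← projF_add_projG a d v, form_add_right, form_d_projG hnd, add_zero]

variable (a d)

/-- **The block reflection `R = π_F − π_G`** (`+1` on `F`, `−1` on `G`). [folklore] -/
def reflOp : V →L[ℝ] V := projF a d - projG a d

omit [FiniteDimensional ℝ W] in
/-- Unfolding `R = π_F − π_G`. [folklore] -/
theorem reflOp_apply (v : V) : reflOp a d v = projF a d v - projG a d v := rfl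

variable {a d}

/-- `R² = 1`. [folklore] -/
theorem reflOp_reflOp (hnd : ∀ u : W, u ≠ 0 → ∃ u' : W, a ![d u, d u'] ≠ 0) (v : V) :
    reflOp a d (reflOp a d v) = v := by
  rw [reflOp_apply, reflOp_apply, map_sub, map_sub, projF_projF hnd, projF_projG hnd, projG_projF hnd,
    projG_projG hnd, sub_zero, zero_sub, sub_neg_eq_add, projF_add_projG]

/-- `π_F R = π_F`. [folklore] -/
theorem projF_reflOp (hnd : ∀ u : W, u ≠ 0 → ∃ u' : W, a ![d u, d u'] ≠ 0) (v : V) :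
    projF a d (reflOp a d v) = projF a d v := by
  rw [reflOp_apply, map_sub, projF_projF hnd, projF_projG hnd, sub_zero]

/-- `π_G R = −π_G`. [folklore] -/
theorem projG_reflOp (hnd : ∀ u : W, u ≠ 0 → ∃ u' : W, a ![d u, d u'] ≠ 0) (v : V) :
    projG a d (reflOp a d v) = -projG a d v := by
  rw [reflOp_apply, map_sub, projG_projF hnd, projG_projG hnd, zero_sub]

/-- The reflection as a linear automorphism (it is an involution). [folklore] -/
def reflEquiv (hnd : ∀ u : W, u ≠ 0 → ∃ u' : W, a ![d u, d u'] ≠ 0) : V ≃L[ℝ] V :=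
  { reflOp a d with
    invFun := reflOp a d
    left_inv := reflOp_reflOp hnd
    right_inv := reflOp_reflOp hnd }

/-- `reflEquiv` is `reflOp` as a map. [folklore] -/
theorem coe_reflEquiv (hnd : ∀ u : W, u ≠ 0 → ∃ u' : W, a ![d u, d u'] ≠ 0) :
    (reflEquiv hnd : V →L[ℝ] V) = reflOp a d := rfl

/-- `reflEquiv⁻¹ = reflOp` (an involution). [folklore] -/
theorem coe_reflEquiv_symm (hnd : ∀ u : W, u ≠ 0 → ∃ u' : W, a ![d u, d u'] ≠ 0) :
    ((reflEquiv hnd).symm : V →L[ℝ] V) = reflOp a d := rfl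

/-- **`a` is invariant under the block reflection.** [folklore] -/
theorem form_reflOp (hnd : ∀ u : W, u ≠ 0 → ∃ u' : W, a ![d u, d u'] ≠ 0) (v w : V) :
    a ![reflOp a d v, reflOp a d w] = a ![v, w] := by
  rw [form_eq_blocks hnd (reflOp a d v), projF_reflOp hnd, projF_reflOp hnd, projG_reflOp hnd,
    projG_reflOp hnd, form_neg_right, form_swap a (-projG a d v), form_neg_right, form_swap a (projG a d w),
    neg_neg, neg_neg, ← form_eq_blocks hnd]

end Projections

/-! ### Metrics: `g_J = a(·, J·)` (symmetrised) and the block metric `g(π_F·, π_F·) + g(π_G·, π_G·)` -/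

section Metrics

variable (a : V [⋀^Fin 2]→L[ℝ] ℝ) (d : W →L[ℝ] V) (g : V →L[ℝ] V →L[ℝ] ℝ)

/-- **The block metric** `g̃(v, w) = g(π_F v, π_F w) + g(π_G v, π_G w)`: an inner product for which
`F ⟂ G` (McDuff–Salamon 2017, proof of Prop. 2.6.4: a Hermitian structure adapted to a symplectic
splitting). [cite: McDuffSalamon2017, Prop. 2.6.4] -/
def blockMetric : V →L[ℝ] V →L[ℝ] ℝ := bilinPrecomp g (projF a d) + bilinPrecomp g (projG a d)

omit [FiniteDimensional ℝ W] in
/-- Unfolding the block metric. [folklore] -/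
theorem blockMetric_apply (v w : V) :
    blockMetric a d g v w = g (projF a d v) (projF a d w) + g (projG a d v) (projG a d w) := rfl

variable {a d g}

omit [FiniteDimensional ℝ W] in
/-- The block metric of a symmetric form is symmetric. [folklore] -/
theorem blockMetric_symm (hgs : ∀ v w, g v w = g w v) (v w : V) :
    blockMetric a d g v w = blockMetric a d g w v := by
  rw [blockMetric_apply, blockMetric_apply, hgs (projF a d v), hgs (projG a d v)]

omit [FiniteDimensional ℝ W] in
/-- The block metric of a positive definite form is positive definite (`v = π_F v + π_G v`). [folklore] -/
theorem blockMetric_self_pos (hgp : ∀ v, v ≠ 0 → 0 < g v v) {v : V} (hv : v ≠ 0) :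
    0 < blockMetric a d g v v := by
  have hnn : ∀ x : V, 0 ≤ g x x := fun x ↦ by
    by_cases hx : x = 0
    · subst hx; simp
    · exact (hgp x hx).le
  rw [blockMetric_apply]
  by_cases hF : projF a d v = 0
  · have hG : projG a d v ≠ 0 := fun hG ↦ hv (by rw [← projF_add_projG a d v, hF, hG, add_zero])
    exact add_pos_of_nonneg_of_pos (hnn _) (hgp _ hG)
  · exact add_pos_of_pos_of_nonneg (hgp _ hF) (hnn _)

/-- The block metric is invariant under the block reflection. [folklore] -/
theorem blockMetric_reflOp (hnd : ∀ u : W, u ≠ 0 → ∃ u' : W, a ![d u, d u'] ≠ 0) (v w : V) :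
    blockMetric a d g (reflOp a d v) (reflOp a d w) = blockMetric a d g v w := by
  rw [blockMetric_apply, blockMetric_apply, projF_reflOp hnd, projF_reflOp hnd, projG_reflOp hnd,
    projG_reflOp hnd]
  simp only [map_neg, neg_apply, neg_neg]

/-- `F ⟂ G` for the block metric: `g̃(π_F v, π_G w) = 0`. [folklore] -/
theorem blockMetric_projF_projG (hnd : ∀ u : W, u ≠ 0 → ∃ u' : W, a ![d u, d u'] ≠ 0) (v w : V) :
    blockMetric a d g (projF a d v) (projG a d w) = 0 := by
  rw [blockMetric_apply, projF_projF hnd, projF_projG hnd, projG_projF hnd]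
  simp only [map_zero, zero_apply, zero_add]

/-- On `G` the block metric is `g`. [folklore] -/
theorem blockMetric_projG_projG (hnd : ∀ u : W, u ≠ 0 → ∃ u' : W, a ![d u, d u'] ≠ 0) (v w : V) :
    blockMetric a d g (projG a d v) (projG a d w) = g (projG a d v) (projG a d w) := by
  rw [blockMetric_apply, projF_projG hnd, projG_projG hnd, projG_projG hnd]
  simp only [map_zero, zero_apply, zero_add]

end Metrics

/-! ### The adapted compatible complex structure `J̃ = J_{g̃, a}` -/

section Adapted

variable (a : V [⋀^Fin 2]→L[ℝ] ℝ) (d : W →L[ℝ] V) (J : V →L[ℝ] V)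

/-- **The adapted compatible complex structure `J̃ := J_{g̃, a}`** (McDuff–Salamon 2017,
Prop. 2.5.6 / Prop. 2.6.4 (iii): the compatible complex structure of a metric and a symplectic
form) for the block metric `g̃` of `g_J` and the splitting `V = d(W) ⊕ d(W)^a`; it preserves both
summands (`adaptedJ_projF`, `adaptedJ_projG`). [cite: McDuffSalamon2017, Prop. 2.6.4] -/
def adaptedJ : V →L[ℝ] V :=
  polarJOfMetric (gram (blockMetric a d (tameMetric a J))) (formOp a)

variable {a d J} (ha : ∀ v : V, v ≠ 0 → ∃ w : V, a ![v, w] ≠ 0)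
  (hnd : ∀ u : W, u ≠ 0 → ∃ u' : W, a ![d u, d u'] ≠ 0) (hJt : ∀ v : V, v ≠ 0 → 0 < a ![v, J v])

omit [FiniteDimensional ℝ W] in
include hJt in
/-- The Gram operator of the block metric of `g_J` is symmetric positive definite. [folklore] -/
theorem isPosDefSymm_gram_blockMetric :
    IsPosDefSymm (gram (blockMetric a d (tameMetric a J))) :=
  isPosDefSymm_gram (blockMetric_symm (tameMetric_symm a J))
    fun _ hv ↦ blockMetric_self_pos (fun _ hw ↦ tameMetric_self_pos a hJt hw) hv

omit [CompleteSpace V] in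
include ha in
/-- The Gram operator of a nondegenerate `2`-form is skew and nondegenerate. [folklore] -/
theorem isSkewNondeg_formOp : IsSkewNondeg (formOp a) := isSkewNondeg_gram_bilinOfAlt a ha

include ha hJt

omit [FiniteDimensional ℝ W] in
/-- **`J̃² = -1`.** [cite: McDuffSalamon2017, Prop. 2.5.6] -/
theorem adaptedJ_adaptedJ (v : V) : adaptedJ a d J (adaptedJ a d J v) = -v :=
  polarJOfMetric_polarJOfMetric_apply (isPosDefSymm_gram_blockMetric hJt) (isSkewNondeg_formOp ha) v

omit [FiniteDimensional ℝ W] in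
/-- `J̃ · J̃ = −1` in operator form. [cite: McDuffSalamon2017, Prop. 2.5.6] -/
theorem adaptedJ_mul_adaptedJ : adaptedJ a d J * adaptedJ a d J = -1 :=
  polarJOfMetric_mul_self (isPosDefSymm_gram_blockMetric hJt) (isSkewNondeg_formOp ha)

omit [FiniteDimensional ℝ W] in
/-- **`J̃` is tamed by `a`**: `a(v, J̃ v) > 0`. [cite: McDuffSalamon2017, Prop. 2.5.6 (2.5.10)] -/
theorem form_self_adaptedJ_pos {v : V} (hv : v ≠ 0) : 0 < a ![v, adaptedJ a d J v] := by
  have h := inner_gram_self_polarJOfMetric_pos (isPosDefSymm_gram_blockMetric (a := a) (d := d) hJt)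
    (isSkewNondeg_formOp ha) hv
  rwa [inner_formOp] at h

omit [FiniteDimensional ℝ W] in
/-- **`a` is `J̃`-invariant**: `a(J̃ v, J̃ w) = a(v, w)`. [cite: McDuffSalamon2017, Prop. 2.5.6 (2.5.10)] -/
theorem form_adaptedJ (v w : V) : a ![adaptedJ a d J v, adaptedJ a d J w] = a ![v, w] := by
  have h := inner_gram_polarJOfMetric (isPosDefSymm_gram_blockMetric (a := a) (d := d) hJt)
    (isSkewNondeg_formOp ha) v w
  rwa [inner_formOp, inner_formOp] at h

omit [FiniteDimensional ℝ W] in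
/-- **`J̃` is `g̃`-orthogonal.** [cite: McDuffSalamon2017, Prop. 2.5.6 (2.5.10)] -/
theorem blockMetric_adaptedJ (v w : V) :
    blockMetric a d (tameMetric a J) (adaptedJ a d J v) (adaptedJ a d J w) =
      blockMetric a d (tameMetric a J) v w := by
  have h := inner_metric_polarJOfMetric (isPosDefSymm_gram_blockMetric (a := a) (d := d) hJt)
    (isSkewNondeg_formOp ha) v w
  rwa [inner_gram_left, inner_gram_left] at h

omit [FiniteDimensional ℝ W] in
/-- `g̃(v, J̃ v) = 0` (`J̃` is `g̃`-orthogonal with square `−1`, hence `g̃`-skew). [folklore] -/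
theorem blockMetric_self_adaptedJ (v : V) :
    blockMetric a d (tameMetric a J) v (adaptedJ a d J v) = 0 := by
  have h1 := blockMetric_adaptedJ ha hJt (d := d) v (adaptedJ a d J v)
  rw [adaptedJ_adaptedJ ha hJt, map_neg] at h1
  have h2 := blockMetric_symm (a := a) (d := d) (tameMetric_symm a J) (adaptedJ a d J v) v
  linarith

include hnd

/-- **`J̃` commutes with the block reflection** (`GL`-equivariance of `(g, ω) ↦ J_{g,ω}`,
McDuff–Salamon 2017, Prop. 2.5.6, applied to `R = π_F − π_G`, which preserves `g̃` and `a`).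
[cite: McDuffSalamon2017, Prop. 2.5.6] -/
theorem reflOp_adaptedJ (v : V) : reflOp a d (adaptedJ a d J v) = adaptedJ a d J (reflOp a d v) := by
  have hG := isPosDefSymm_gram_blockMetric (a := a) (d := d) hJt
  have hΩ := isSkewNondeg_formOp ha
  set R := reflEquiv hnd (a := a) (d := d)
  have h1 : gram (blockMetric a d (tameMetric a J)) =
      ContinuousLinearMap.adjoint (R.symm : V →L[ℝ] V) * gram (blockMetric a d (tameMetric a J)) *
        (R.symm : V →L[ℝ] V) :=
    gram_eq_adjoint_mul_gram_mul fun v w ↦ by rw [coe_reflEquiv_symm, blockMetric_reflOp hnd]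
  have h2 : formOp a = ContinuousLinearMap.adjoint (R.symm : V →L[ℝ] V) * formOp a *
      (R.symm : V →L[ℝ] V) :=
    gram_eq_adjoint_mul_gram_mul fun v w ↦ by
      rw [coe_reflEquiv_symm, bilinOfAlt_apply, bilinOfAlt_apply, form_reflOp hnd]
  have key := polarJOfMetric_conj hG hΩ R
  rw [← h1, ← h2] at key
  -- `key : J̃ = R * J̃ * R⁻¹`; evaluate at `R v`
  have hs : (R.symm : V →L[ℝ] V) (reflOp a d v) = v := R.symm_apply_apply v
  have happ := congrArg (fun T : V →L[ℝ] V ↦ T (reflOp a d v)) key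
  change adaptedJ a d J (reflOp a d v) =
    R (adaptedJ a d J ((R.symm : V →L[ℝ] V) (reflOp a d v))) at happ
  rw [hs] at happ
  rw [happ]
  rfl

/-- **`J̃` preserves `F`**: `J̃ π_F = π_F J̃` (`π_F = ½(1 + R)`). [cite: McDuffSalamon2017, Prop. 2.6.4] -/
theorem adaptedJ_projF (v : V) : adaptedJ a d J (projF a d v) = projF a d (adaptedJ a d J v) := by
  have h2 : ∀ x : V, (2 : ℝ) • projF a d x = x + reflOp a d x := fun x ↦ by
    have hx := projF_add_projG a d x
    rw [reflOp_apply, two_smul]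
    nth_rw 3 [← hx]
    abel
  have h := h2 (adaptedJ a d J v)
  rw [reflOp_adaptedJ ha hnd hJt, ← map_add, ← h2, map_smul] at h
  exact (smul_right_injective V (two_ne_zero' ℝ) h).symm

/-- **`J̃` preserves `G`**: `J̃ π_G = π_G J̃`. [cite: McDuffSalamon2017, Prop. 2.6.4] -/
theorem adaptedJ_projG (v : V) : adaptedJ a d J (projG a d v) = projG a d (adaptedJ a d J v) := by
  rw [projG_apply, projG_apply, map_sub, ← projF_apply, ← projF_apply, adaptedJ_projF ha hnd hJt]

/-- `J̃ (d u) ∈ F`. [folklore] -/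
theorem adaptedJ_d (u : W) : adaptedJ a d J (d u) = projF a d (adaptedJ a d J (d u)) := by
  conv_lhs => rw [← projF_d hnd u]
  exact adaptedJ_projF ha hnd hJt (d u)

/-- `L (J̃ (π_G v)) = 0`: `J̃` maps `G` to `G = ker L`. [folklore] -/
theorem leftInv_adaptedJ_projG (v : V) : leftInv a d (adaptedJ a d J (projG a d v)) = 0 := by
  rw [adaptedJ_projG ha hnd hJt, leftInv_projG hnd]

end Adapted

/-! ### The induced complex structure `j_W = L J̃ d` on `W` and the intertwiners -/

section Tangent

variable (a : V [⋀^Fin 2]→L[ℝ] ℝ) (d : W →L[ℝ] V) (J : V →L[ℝ] V)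

/-- **The complex structure `j_W := L ∘ J̃ ∘ d` induced on `W ≅ F`** (the restriction of `J̃` to the
`J̃`-invariant summand `F = d(W)`, read on `W`). [cite: McDuffSalamon2017, Prop. 2.6.4] -/
def tangentJ : W →L[ℝ] W := (leftInv a d).comp ((adaptedJ a d J).comp d)

omit [FiniteDimensional ℝ W] in
/-- Unfolding `j_W = L ∘ J̃ ∘ d`. [folklore] -/
theorem tangentJ_apply (u : W) : tangentJ a d J u = leftInv a d (adaptedJ a d J (d u)) := rfl

variable {a d J} (ha : ∀ v : V, v ≠ 0 → ∃ w : V, a ![v, w] ≠ 0)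
  (hnd : ∀ u : W, u ≠ 0 → ∃ u' : W, a ![d u, d u'] ≠ 0) (hJt : ∀ v : V, v ≠ 0 → 0 < a ![v, J v])
include ha hnd hJt

/-- `d ∘ j_W = J̃ ∘ d`: `d` is complex-linear `(W, j_W) → (V, J̃)`. [folklore] -/
theorem d_tangentJ (u : W) : d (tangentJ a d J u) = adaptedJ a d J (d u) := by
  rw [tangentJ_apply, ← projF_apply, ← adaptedJ_d ha hnd hJt]

/-- **`j_W² = -1`.** [folklore] -/
theorem tangentJ_tangentJ (u : W) : tangentJ a d J (tangentJ a d J u) = -u := by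
  rw [tangentJ_apply, d_tangentJ ha hnd hJt, adaptedJ_adaptedJ ha hJt, map_neg, leftInv_d hnd]

/-- `j_W · j_W = −1` in operator form. [folklore] -/
theorem tangentJ_mul_tangentJ : tangentJ a d J * tangentJ a d J = -1 :=
  ContinuousLinearMap.ext fun u ↦ tangentJ_tangentJ ha hnd hJt u

/-- **`j_W` is tamed by `d^* a`**: `a(d u, d (j_W u)) > 0` for `u ≠ 0`. [cite: McDuffSalamon2017, §3.4 p. 114] -/
theorem form_d_self_tangentJ_pos {u : W} (hu : u ≠ 0) : 0 < a ![d u, d (tangentJ a d J u)] := by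
  rw [d_tangentJ ha hnd hJt]
  exact form_self_adaptedJ_pos ha hJt (d_ne_zero hnd hu)

/-- **`L ∘ J̃ = j_W ∘ L`.** [folklore] -/
theorem leftInv_adaptedJ (v : V) : leftInv a d (adaptedJ a d J v) = tangentJ a d J (leftInv a d v) := by
  conv_lhs => rw [← projF_add_projG a d v, map_add, map_add, projF_apply,
    leftInv_adaptedJ_projG ha hnd hJt, add_zero]
  rfl

end Tangent

/-! ### The symplectic complement `G` as a complex line (`dim V = dim W + 2`) -/

section Line

variable (a : V [⋀^Fin 2]→L[ℝ] ℝ) (d : W →L[ℝ] V) (J : V →L[ℝ] V)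

/-- **The symplectic complement `G = F^a = ker L`** of `F = d(W)` as a subspace of `V`.
[cite: McDuffSalamon2017, §2.1 (2.1.1)] -/
def normalSpace : Submodule ℝ V := LinearMap.ker (leftInv a d : V →ₗ[ℝ] W)

omit [FiniteDimensional ℝ W] in
/-- `v ∈ G ↔ L v = 0`. [folklore] -/
theorem mem_normalSpace_iff (v : V) : v ∈ normalSpace a d ↔ leftInv a d v = 0 := LinearMap.mem_ker

variable {a d J} (ha : ∀ v : V, v ≠ 0 → ∃ w : V, a ![v, w] ≠ 0)
  (hnd : ∀ u : W, u ≠ 0 → ∃ u' : W, a ![d u, d u'] ≠ 0) (hJt : ∀ v : V, v ≠ 0 → 0 < a ![v, J v])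

include hnd in
/-- `π_G v ∈ G`. [folklore] -/
theorem projG_mem_normalSpace (v : V) : projG a d v ∈ normalSpace a d :=
  (mem_normalSpace_iff a d _).2 (leftInv_projG hnd v)

omit [FiniteDimensional ℝ W] in
/-- `π_G` is the identity on `G`. [folklore] -/
theorem projG_eq_self_of_mem {v : V} (hv : v ∈ normalSpace a d) : projG a d v = v := by
  rw [projG_apply, (mem_normalSpace_iff a d v).1 hv, map_zero, sub_zero]

include ha hnd hJt in
/-- `J̃` preserves `G`. [cite: McDuffSalamon2017, Prop. 2.6.4] -/
theorem adaptedJ_mem_normalSpace {v : V} (hv : v ∈ normalSpace a d) :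
    adaptedJ a d J v ∈ normalSpace a d := by
  rw [mem_normalSpace_iff, leftInv_adaptedJ ha hnd hJt, (mem_normalSpace_iff a d v).1 hv, map_zero]

include hnd in
/-- **`dim W + dim W^a = dim V`** (McDuff–Salamon 2017, Lemma 2.1.1), here as
`dim G + dim W = dim V` for `G = d(W)^a`, `d` injective. [cite: McDuffSalamon2017, Lemma 2.1.1] -/
theorem finrank_normalSpace_add : finrank ℝ (normalSpace a d) + finrank ℝ W = finrank ℝ V := by
  have h := LinearMap.finrank_range_add_finrank_ker (leftInv a d : V →ₗ[ℝ] W)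
  have hr : LinearMap.range (leftInv a d : V →ₗ[ℝ] W) = ⊤ :=
    LinearMap.range_eq_top.2 fun u ↦ ⟨d u, leftInv_d hnd u⟩
  rw [hr, finrank_top] at h
  rw [← h, add_comm]
  rfl

include hnd in
/-- `dim G = 2` when `dim V = dim W + 2`. [cite: McDuffSalamon2017, Lemma 2.1.1] -/
theorem finrank_normalSpace (hdim : finrank ℝ V = finrank ℝ W + 2) : finrank ℝ (normalSpace a d) = 2 := by
  have h := finrank_normalSpace_add (a := a) (d := d) hnd
  omega

include ha hJt in
omit [FiniteDimensional ℝ W] in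
/-- `n` and `J̃ n` are linearly independent for `n ≠ 0` (they are `g̃`-orthogonal of equal
positive length). [folklore] -/
theorem linearIndependent_pair {n : V} (hn : n ≠ 0) : LinearIndependent ℝ ![n, adaptedJ a d J n] := by
  set gt := blockMetric a d (tameMetric a J) with hgt
  have hpos : 0 < gt n n :=
    blockMetric_self_pos (fun _ hw ↦ tameMetric_self_pos a hJt hw) hn
  have horth : gt n (adaptedJ a d J n) = 0 := blockMetric_self_adaptedJ ha hJt n
  have horth' : gt (adaptedJ a d J n) n = 0 := by
    rw [blockMetric_symm (tameMetric_symm a J)]; exact horth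
  have hJJ : gt (adaptedJ a d J n) (adaptedJ a d J n) = gt n n := blockMetric_adaptedJ ha hJt n n
  refine LinearIndependent.pair_iff.2 fun s t hst ↦ ?_
  have h1 := congrArg (fun x ↦ gt x n) hst
  have h2 := congrArg (fun x ↦ gt x (adaptedJ a d J n)) hst
  simp only [map_add, map_smul, add_apply, smul_apply, smul_eq_mul, map_zero, zero_apply, horth,
    horth', hJJ, mul_zero, add_zero, zero_add] at h1 h2
  exact ⟨(mul_eq_zero.1 h1).resolve_right hpos.ne', (mul_eq_zero.1 h2).resolve_right hpos.ne'⟩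

include ha hnd hJt in
/-- **`G` is the complex line spanned by `n`**: for `dim V = dim W + 2` and `0 ≠ n ∈ G`, every
`v ∈ G` is `x n + y J̃ n`. [cite: McDuffSalamon2017, Lemma 2.1.1] -/
theorem exists_eq_lincomb (hdim : finrank ℝ V = finrank ℝ W + 2) {n : V} (hn : n ∈ normalSpace a d)
    (hn0 : n ≠ 0) {v : V} (hv : v ∈ normalSpace a d) :
    ∃ x y : ℝ, x • n + y • adaptedJ a d J n = v := by
  set b : Fin 2 → V := ![n, adaptedJ a d J n]
  have hli : LinearIndependent ℝ b := linearIndependent_pair ha hJt hn0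
  have hle : Submodule.span ℝ (Set.range b) ≤ normalSpace a d := by
    refine Submodule.span_le.2 ?_
    rintro _ ⟨i, rfl⟩
    fin_cases i
    · exact hn
    · exact adaptedJ_mem_normalSpace ha hnd hJt hn
  have heq : Submodule.span ℝ (Set.range b) = normalSpace a d :=
    Submodule.eq_of_le_of_finrank_eq hle (by rw [finrank_span_eq_card hli, finrank_normalSpace hnd hdim]; rfl)
  have hv' : v ∈ Submodule.span ℝ (Set.range b) := heq ▸ hv
  obtain ⟨c, hc⟩ := (Submodule.mem_span_range_iff_exists_fun ℝ).1 hv'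
  refine ⟨c 0, c 1, ?_⟩
  rw [Fin.sum_univ_two] at hc
  exact hc

variable (a d J)

/-- The squared `g̃`-length `|n|²` of the frame vector. [folklore] -/
def frameNormSq (n : V) : ℝ := blockMetric a d (tameMetric a J) n n

/-- **The real coordinate** `v ↦ g̃(π_G v, n) / |n|²` of `G` in the frame `n, J̃ n`. [folklore] -/
def lineRe (n : V) : V →L[ℝ] ℝ :=
  (frameNormSq a d J n)⁻¹ • ((blockMetric a d (tameMetric a J)).flip n).comp (projG a d)

/-- **The imaginary coordinate** `v ↦ g̃(π_G v, J̃ n) / |n|²`. [folklore] -/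
def lineIm (n : V) : V →L[ℝ] ℝ :=
  (frameNormSq a d J n)⁻¹ • ((blockMetric a d (tameMetric a J)).flip (adaptedJ a d J n)).comp (projG a d)

/-- **The complex coordinate of the line `G` in the frame `n`**: the `ℝ`-linear map `V → ℂ`,
`v ↦ (g̃(π_G v, n) + i g̃(π_G v, J̃ n)) / |n|²`, complex-linear for `J̃` (`lineCoord_adaptedJ`),
`1` at `n`, and inverse to `z ↦ (re z) n + (im z) J̃ n` on `G` (`lineCoord_expand`).
[cite: McDuffSalamon2017, §2.6 (unitary trivialisations)] -/
def lineCoord (n : V) : V →L[ℝ] ℂ :=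
  Complex.ofRealCLM.comp (lineRe a d J n) + Complex.I • Complex.ofRealCLM.comp (lineIm a d J n)

omit [FiniteDimensional ℝ W] in
/-- Unfolding `lineRe`. [folklore] -/
theorem lineRe_apply (n v : V) :
    lineRe a d J n v = (frameNormSq a d J n)⁻¹ * blockMetric a d (tameMetric a J) (projG a d v) n := rfl

omit [FiniteDimensional ℝ W] in
/-- Unfolding `lineIm`. [folklore] -/
theorem lineIm_apply (n v : V) :
    lineIm a d J n v =
      (frameNormSq a d J n)⁻¹ * blockMetric a d (tameMetric a J) (projG a d v) (adaptedJ a d J n) := rfl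

omit [FiniteDimensional ℝ W] in
/-- Unfolding `lineCoord = lineRe + i lineIm`. [folklore] -/
theorem lineCoord_apply (n v : V) :
    lineCoord a d J n v = (lineRe a d J n v : ℂ) + Complex.I * (lineIm a d J n v : ℂ) := rfl

omit [FiniteDimensional ℝ W] in
/-- `re (lineCoord n v) = lineRe n v`. [folklore] -/
@[simp]
theorem lineCoord_re (n v : V) : (lineCoord a d J n v).re = lineRe a d J n v := by
  rw [lineCoord_apply]; simp

omit [FiniteDimensional ℝ W] in
/-- `im (lineCoord n v) = lineIm n v`. [folklore] -/
@[simp]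
theorem lineCoord_im (n v : V) : (lineCoord a d J n v).im = lineIm a d J n v := by
  rw [lineCoord_apply]; simp

omit [FiniteDimensional ℝ W] in
/-- `lineCoord n v = ⟨lineRe n v, lineIm n v⟩`. [folklore] -/
theorem lineCoord_eq_mk (n v : V) : lineCoord a d J n v = ⟨lineRe a d J n v, lineIm a d J n v⟩ :=
  Complex.ext (lineCoord_re a d J n v) (lineCoord_im a d J n v)

variable {a d J}

include hnd in
/-- `lineRe` factors through `π_G`. [folklore] -/
theorem lineRe_projG (n v : V) : lineRe a d J n (projG a d v) = lineRe a d J n v := by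
  rw [lineRe_apply, lineRe_apply, projG_projG hnd]

include hnd in
/-- `lineIm` factors through `π_G`. [folklore] -/
theorem lineIm_projG (n v : V) : lineIm a d J n (projG a d v) = lineIm a d J n v := by
  rw [lineIm_apply, lineIm_apply, projG_projG hnd]

include hnd in
/-- `lineCoord` factors through `π_G`. [folklore] -/
theorem lineCoord_projG (n v : V) : lineCoord a d J n (projG a d v) = lineCoord a d J n v := by
  rw [lineCoord_eq_mk, lineCoord_eq_mk, lineRe_projG hnd, lineIm_projG hnd]

include hJt in
omit [FiniteDimensional ℝ W] in
/-- `|n|² > 0` for `n ≠ 0`. [folklore] -/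
theorem frameNormSq_pos {n : V} (hn : n ≠ 0) : 0 < frameNormSq a d J n :=
  blockMetric_self_pos (fun _ hw ↦ tameMetric_self_pos a hJt hw) hn

include ha hnd hJt

/-- The coordinates of `x n + y J̃ n` are `(x, y)`. [folklore] -/
theorem lineRe_lincomb {n : V} (hn : n ∈ normalSpace a d) (hn0 : n ≠ 0) (x y : ℝ) :
    lineRe a d J n (x • n + y • adaptedJ a d J n) = x := by
  have hmem : x • n + y • adaptedJ a d J n ∈ normalSpace a d :=
    add_mem (Submodule.smul_mem _ _ hn) (Submodule.smul_mem _ _ (adaptedJ_mem_normalSpace ha hnd hJt hn))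
  have hc : frameNormSq a d J n ≠ 0 := (frameNormSq_pos hJt hn0).ne'
  rw [lineRe_apply, projG_eq_self_of_mem hmem, map_add, map_smul, map_smul, add_apply, smul_apply,
    smul_apply, blockMetric_symm (tameMetric_symm a J) (adaptedJ a d J n) n,
    blockMetric_self_adaptedJ ha hJt, smul_zero, add_zero, smul_eq_mul]
  change (frameNormSq a d J n)⁻¹ * (x * frameNormSq a d J n) = x
  rw [mul_comm x, ← mul_assoc, inv_mul_cancel₀ hc, one_mul]

/-- The imaginary coordinate of `x n + y J̃ n` is `y`. [folklore] -/
theorem lineIm_lincomb {n : V} (hn : n ∈ normalSpace a d) (hn0 : n ≠ 0) (x y : ℝ) :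
    lineIm a d J n (x • n + y • adaptedJ a d J n) = y := by
  have hmem : x • n + y • adaptedJ a d J n ∈ normalSpace a d :=
    add_mem (Submodule.smul_mem _ _ hn) (Submodule.smul_mem _ _ (adaptedJ_mem_normalSpace ha hnd hJt hn))
  have hc : frameNormSq a d J n ≠ 0 := (frameNormSq_pos hJt hn0).ne'
  rw [lineIm_apply, projG_eq_self_of_mem hmem, map_add, map_smul, map_smul, add_apply, smul_apply,
    smul_apply, blockMetric_self_adaptedJ ha hJt, blockMetric_adaptedJ ha hJt, smul_zero, zero_add,
    smul_eq_mul]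
  change (frameNormSq a d J n)⁻¹ * (y * frameNormSq a d J n) = y
  rw [mul_comm y, ← mul_assoc, inv_mul_cancel₀ hc, one_mul]

/-- The complex coordinate of `x n + y J̃ n` is `x + i y`. [folklore] -/
theorem lineCoord_lincomb {n : V} (hn : n ∈ normalSpace a d) (hn0 : n ≠ 0) (x y : ℝ) :
    lineCoord a d J n (x • n + y • adaptedJ a d J n) = ⟨x, y⟩ := by
  rw [lineCoord_eq_mk, lineRe_lincomb ha hnd hJt hn hn0, lineIm_lincomb ha hnd hJt hn hn0]

/-- **`lineCoord n n = 1`.** [folklore] -/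
theorem lineCoord_self {n : V} (hn : n ∈ normalSpace a d) (hn0 : n ≠ 0) : lineCoord a d J n n = 1 := by
  have h := lineCoord_lincomb ha hnd hJt hn hn0 1 0
  rwa [one_smul, zero_smul, add_zero] at h

/-- `lineCoord n (J̃ n) = i`. [folklore] -/
theorem lineCoord_adaptedJ_self {n : V} (hn : n ∈ normalSpace a d) (hn0 : n ≠ 0) :
    lineCoord a d J n (adaptedJ a d J n) = Complex.I := by
  have h := lineCoord_lincomb ha hnd hJt hn hn0 0 1
  rwa [one_smul, zero_smul, zero_add] at h

/-- **The frame expansion**: `(re κ v) n + (im κ v) J̃ n = π_G v` for `κ = lineCoord n`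
(`dim V = dim W + 2`, `0 ≠ n ∈ G`). [folklore] -/
theorem lineCoord_expand (hdim : finrank ℝ V = finrank ℝ W + 2) {n : V} (hn : n ∈ normalSpace a d)
    (hn0 : n ≠ 0) (v : V) :
    (lineRe a d J n v) • n + (lineIm a d J n v) • adaptedJ a d J n = projG a d v := by
  obtain ⟨x, y, hxy⟩ := exists_eq_lincomb ha hnd hJt hdim hn hn0 (projG_mem_normalSpace hnd v)
  rw [← lineRe_projG hnd, ← lineIm_projG hnd, ← hxy, lineRe_lincomb ha hnd hJt hn hn0,
    lineIm_lincomb ha hnd hJt hn hn0]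

/-- On `G` the coordinate is injective. [folklore] -/
theorem eq_zero_of_lineCoord_eq_zero (hdim : finrank ℝ V = finrank ℝ W + 2) {n : V}
    (hn : n ∈ normalSpace a d) (hn0 : n ≠ 0) {v : V} (hv : v ∈ normalSpace a d)
    (h0 : lineCoord a d J n v = 0) : v = 0 := by
  have h := lineCoord_expand ha hnd hJt hdim hn hn0 v
  rw [projG_eq_self_of_mem hv, ← lineCoord_re, ← lineCoord_im, h0] at h
  simpa using h.symm

/-- **`κ_n` is complex-linear for `J̃`**: `κ_n (J̃ v) = i κ_n v`. [folklore] -/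
theorem lineCoord_adaptedJ (hdim : finrank ℝ V = finrank ℝ W + 2) {n : V} (hn : n ∈ normalSpace a d)
    (hn0 : n ≠ 0) (v : V) :
    lineCoord a d J n (adaptedJ a d J v) = Complex.I * lineCoord a d J n v := by
  have h := lineCoord_expand ha hnd hJt hdim hn hn0 v
  have hJ : (-(lineIm a d J n v)) • n + (lineRe a d J n v) • adaptedJ a d J n =
      projG a d (adaptedJ a d J v) := by
    rw [← adaptedJ_projG ha hnd hJt, ← h, map_add, map_smul, map_smul, adaptedJ_adaptedJ ha hJt,
      smul_neg, neg_smul]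
    abel
  have hc := congrArg (lineCoord a d J n) hJ
  rw [lineCoord_lincomb ha hnd hJt hn hn0, lineCoord_projG hnd] at hc
  rw [← hc, lineCoord_eq_mk a d J n v, Complex.ext_iff]
  simp

/-- **The cocycle of frames**: `κ_{n'} v = κ_{n'}(n) · κ_n v`. [folklore] -/
theorem lineCoord_mul (hdim : finrank ℝ V = finrank ℝ W + 2) {n n' : V} (hn : n ∈ normalSpace a d)
    (hn0 : n ≠ 0) (hn' : n' ∈ normalSpace a d) (hn0' : n' ≠ 0) (v : V) :
    lineCoord a d J n' v = lineCoord a d J n' n * lineCoord a d J n v := by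
  have h := lineCoord_expand ha hnd hJt hdim hn hn0 v
  have hc := congrArg (lineCoord a d J n') h
  rw [lineCoord_projG hnd, map_add, map_smul, map_smul, lineCoord_adaptedJ ha hnd hJt hdim hn' hn0'] at hc
  rw [← hc]
  conv_rhs => rw [lineCoord_eq_mk a d J n v]
  rw [Complex.ext_iff]
  simp only [Complex.add_re, Complex.add_im, Complex.real_smul, Complex.mul_re, Complex.mul_im,
    Complex.ofReal_re, Complex.ofReal_im, Complex.I_re, Complex.I_im]
  constructor <;> ring

end Line

/-! ### The intertwiners and the splitting map `(V, J) → (W, j) × (G, J̃)` -/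

section Split

/-! Local copies of three elementary facts on `jInterp J₁ J₀ = ½(1 − J₁ J₀)` (they are proved in
`ChernClassTameIndependence.lean`; restated privately to keep this file's imports light). -/

omit [FiniteDimensional ℝ V] [CompleteSpace V] in
/-- `½(1 − J₁ J₀) v = ½ (v − J₁ J₀ v)`. [folklore] -/
private theorem jInterp_apply_eq (J₁ J₀ : V →L[ℝ] V) (v : V) :
    jInterp J₁ J₀ v = (2⁻¹ : ℝ) • (v - J₁ (J₀ v)) := rfl

omit [FiniteDimensional ℝ V] [CompleteSpace V] in
/-- `J₁ (C v) = C (J₀ v)` for `C = ½(1 − J₁ J₀)`. [folklore] -/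
private theorem apply_jInterp {J₁ J₀ : V →L[ℝ] V} (h₁ : J₁ * J₁ = -1) (h₀ : J₀ * J₀ = -1) (v : V) :
    J₁ (jInterp J₁ J₀ v) = jInterp J₁ J₀ (J₀ v) :=
  congrArg (fun T : V →L[ℝ] V ↦ T v) (mul_jInterp h₁ h₀)

omit [CompleteSpace V] in
/-- `½(1 − J₁ J₀)` is bijective when `J₀`, `J₁` are tamed by the same `2`-form (McDuff–Salamon 2017, §4.1 (4.1.1); the tree's `jInterp_bijective_of_tame`). [cite: McDuffSalamon2017, Thm. 2.6.3] -/
private theorem jInterp_bijective (a : V [⋀^Fin 2]→L[ℝ] ℝ) {J₀ J₁ : V →L[ℝ] V} (h₀ : J₀ * J₀ = -1)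
    (ht₀ : ∀ v, v ≠ 0 → 0 < a ![v, J₀ v]) (ht₁ : ∀ v, v ≠ 0 → 0 < a ![v, J₁ v]) :
    Bijective (jInterp J₁ J₀) := by
  have hinj : Injective (jInterp J₁ J₀) := by
    refine (injective_iff_map_eq_zero _).2 fun v hv ↦ by_contra fun hne ↦ ?_
    have hv' : v = J₁ (J₀ v) := by
      rw [jInterp_apply_eq, smul_eq_zero] at hv
      rcases hv with h | h
      · norm_num at h
      · exact sub_eq_zero.1 h
    have hu : J₀ v ≠ 0 := fun hu0 ↦ hne (by rw [hv', hu0, map_zero])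
    have p1 := ht₁ (J₀ v) hu
    have p0 := ht₀ (J₀ v) hu
    rw [← hv'] at p1
    have h₀v : J₀ (J₀ v) = -v := congrArg (fun T : V →L[ℝ] V ↦ T v) h₀
    rw [h₀v, form_neg_right] at p0
    linarith
  exact ⟨hinj, LinearMap.surjective_of_injective (f := (jInterp J₁ J₀ : V →ₗ[ℝ] V)) hinj⟩

variable (a : V [⋀^Fin 2]→L[ℝ] ℝ) (d : W →L[ℝ] V) (J : V →L[ℝ] V) (j : W →L[ℝ] W)

/-- The pulled-back form `d^* a` on `W`. [folklore] -/
def pullbackForm : W [⋀^Fin 2]→L[ℝ] ℝ := a.compContinuousLinearMap d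

omit [FiniteDimensional ℝ V] [CompleteSpace V] [FiniteDimensional ℝ W] [CompleteSpace W] in
/-- `(d^* a)(u, u') = a(d u, d u')`. [folklore] -/
@[simp]
theorem pullbackForm_apply (u u' : W) : pullbackForm a d ![u, u'] = a ![d u, d u'] := by
  rw [pullbackForm, ContinuousAlternatingMap.compContinuousLinearMap_apply]
  congr 1
  ext i
  fin_cases i <;> rfl

/-- **The ambient intertwiner `Φ = ½(1 − J̃ J) : (V, J) → (V, J̃)`** (McDuff–Salamon 2017, proof of
Thm. 2.6.3 / Prop. 2.6.4: two `ω`-tame complex structures on the same symplectic space are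
intertwined by the canonical isomorphism `½(1 − J₁ J₀)`; the tree's `jInterp`).
[cite: McDuffSalamon2017, Thm. 2.6.3] -/
def ambientIntertwiner : V →L[ℝ] V := jInterp (adaptedJ a d J) J

/-- **The tangential intertwiner `φ = ½(1 − j j_W) : (W, j_W) → (W, j)`.** [cite: McDuffSalamon2017, Thm. 2.6.3] -/
def tangentIntertwiner : W →L[ℝ] W := jInterp j (tangentJ a d J)

/-- **The tangential component `A = φ ∘ L ∘ Φ : (V, J) → (W, j)` of the splitting map.**
[cite: McDuffSalamon2017, Ex. 4.4.5 (`T_Σ X = TΣ ⊕ ν_Σ`)] -/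
def splitF : V →L[ℝ] W :=
  (tangentIntertwiner a d J j).comp ((leftInv a d).comp (ambientIntertwiner a d J))

/-- **The normal component `B = π_G ∘ Φ : (V, J) → (G, J̃)` of the splitting map.**
[cite: McDuffSalamon2017, Ex. 4.4.5; §3.4 p. 114] -/
def splitG : V →L[ℝ] V := (projG a d).comp (ambientIntertwiner a d J)

/-- **The splitting map read in a frame `n` of the line `G`**: `v ↦ (A v, κ_n (B v)) ∈ W × ℂ`.
[cite: McDuffSalamon2017, Ex. 4.4.5] -/
def splitLine (n : V) : V →L[ℝ] W × ℂ := (splitF a d J j).prod ((lineCoord a d J n).comp (splitG a d J))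

omit [FiniteDimensional ℝ W] in
/-- Unfolding `A = φ ∘ L ∘ Φ`. [folklore] -/
theorem splitF_apply (v : V) :
    splitF a d J j v = tangentIntertwiner a d J j (leftInv a d (ambientIntertwiner a d J v)) := rfl

omit [FiniteDimensional ℝ W] in
/-- Unfolding `B = π_G ∘ Φ`. [folklore] -/
theorem splitG_apply (v : V) : splitG a d J v = projG a d (ambientIntertwiner a d J v) := rfl

omit [FiniteDimensional ℝ W] in
/-- Unfolding `splitLine = (A, κ_n ∘ B)`. [folklore] -/
theorem splitLine_apply (n v : V) :
    splitLine a d J j n v = (splitF a d J j v, lineCoord a d J n (splitG a d J v)) := rfl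

variable {a d J j} (ha : ∀ v : V, v ≠ 0 → ∃ w : V, a ![v, w] ≠ 0)
  (hnd : ∀ u : W, u ≠ 0 → ∃ u' : W, a ![d u, d u'] ≠ 0) (hJ : J * J = -1)
  (hJt : ∀ v : V, v ≠ 0 → 0 < a ![v, J v]) (hj : j * j = -1)
  (hjt : ∀ u : W, u ≠ 0 → 0 < a ![d u, d (j u)])

include ha hJ hJt in
omit [FiniteDimensional ℝ W] in
/-- **`Φ J = J̃ Φ`.** [cite: McDuffSalamon2017, Thm. 2.6.3] -/
theorem ambientIntertwiner_J (v : V) :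
    ambientIntertwiner a d J (J v) = adaptedJ a d J (ambientIntertwiner a d J v) :=
  (apply_jInterp (adaptedJ_mul_adaptedJ ha hJt) hJ v).symm

include ha hJ hJt in
omit [FiniteDimensional ℝ W] in
/-- **`Φ` is bijective** (both `J` and `J̃` are `a`-tame). [cite: McDuffSalamon2017, Thm. 2.6.3] -/
theorem ambientIntertwiner_bijective : Bijective (ambientIntertwiner a d J) :=
  jInterp_bijective a hJ hJt fun _ hv ↦ form_self_adaptedJ_pos ha hJt hv

include ha hnd hJt hj in
/-- **`φ j_W = j φ`.** [cite: McDuffSalamon2017, Thm. 2.6.3] -/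
theorem tangentIntertwiner_tangentJ (u : W) :
    tangentIntertwiner a d J j (tangentJ a d J u) = j (tangentIntertwiner a d J j u) :=
  (apply_jInterp hj (tangentJ_mul_tangentJ ha hnd hJt) u).symm

include ha hnd hJt hjt in
/-- **`φ` is bijective** (both `j` and `j_W` are `d^*a`-tame). [cite: McDuffSalamon2017, Thm. 2.6.3] -/
theorem tangentIntertwiner_bijective : Bijective (tangentIntertwiner a d J j) := by
  have h := jInterp_bijective (pullbackForm a d) (J₀ := tangentJ a d J) (J₁ := j)
    (tangentJ_mul_tangentJ ha hnd hJt) (fun u hu ↦ ?_) (fun u hu ↦ ?_)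
  · exact h
  · rw [pullbackForm_apply]; exact form_d_self_tangentJ_pos ha hnd hJt hu
  · rw [pullbackForm_apply]; exact hjt u hu

include ha hnd hJ hJt hj in
/-- **The tangential component is complex-linear**: `A (J v) = j (A v)`. [cite: McDuffSalamon2017, Ex. 4.4.5] -/
theorem splitF_J (v : V) : splitF a d J j (J v) = j (splitF a d J j v) := by
  rw [splitF_apply, splitF_apply, ambientIntertwiner_J ha hJ hJt, leftInv_adaptedJ ha hnd hJt,
    tangentIntertwiner_tangentJ ha hnd hJt hj]

include ha hnd hJ hJt in
/-- **The normal component is complex-linear**: `B (J v) = J̃ (B v)`. [cite: McDuffSalamon2017, Ex. 4.4.5] -/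
theorem splitG_J (v : V) : splitG a d J (J v) = adaptedJ a d J (splitG a d J v) := by
  rw [splitG_apply, splitG_apply, ambientIntertwiner_J ha hJ hJt, adaptedJ_projG ha hnd hJt]

include hnd in
/-- `B v ∈ G`. [folklore] -/
theorem splitG_mem_normalSpace (v : V) : splitG a d J v ∈ normalSpace a d :=
  projG_mem_normalSpace hnd _

include hnd in
/-- `π_G (B v) = B v`. [folklore] -/
theorem projG_splitG (v : V) : projG a d (splitG a d J v) = splitG a d J v := projG_projG hnd _

include ha hnd hJ hJt hjt in
/-- **The splitting map `(A, B)` is injective.** [cite: McDuffSalamon2017, Ex. 4.4.5] -/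
theorem eq_zero_of_splitF_eq_zero_of_splitG_eq_zero {v : V} (hF : splitF a d J j v = 0)
    (hG : splitG a d J v = 0) : v = 0 := by
  have h1 : leftInv a d (ambientIntertwiner a d J v) = 0 := by
    rw [splitF_apply] at hF
    exact (injective_iff_map_eq_zero _).1 (tangentIntertwiner_bijective ha hnd hJt hjt).1 _ hF
  have h2 : ambientIntertwiner a d J v = 0 := by
    rw [← projF_add_projG a d (ambientIntertwiner a d J v), projF_apply, h1, map_zero, zero_add]
    exact hG
  exact (injective_iff_map_eq_zero _).1 (ambientIntertwiner_bijective ha hJ hJt).1 _ h2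

include ha hnd hJ hJt hjt in
/-- **The splitting map `(A, B)` is onto `W × G`.** [cite: McDuffSalamon2017, Ex. 4.4.5] -/
theorem exists_splitF_eq_splitG_eq (u : W) {g : V} (hg : g ∈ normalSpace a d) :
    ∃ v : V, splitF a d J j v = u ∧ splitG a d J v = g := by
  obtain ⟨u', hu'⟩ := (tangentIntertwiner_bijective ha hnd hJt hjt).2 u
  obtain ⟨v, hv⟩ := (ambientIntertwiner_bijective (d := d) ha hJ hJt).2 (d u' + g)
  refine ⟨v, ?_, ?_⟩
  · rw [splitF_apply, hv, map_add, leftInv_d hnd, (mem_normalSpace_iff a d g).1 hg, add_zero, hu']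
  · rw [splitG_apply, hv, map_add, projG_d hnd, zero_add, projG_eq_self_of_mem hg]

include ha hnd hJ hJt hj in
/-- **The splitting map in a frame is complex-linear**: `(A, κ B)(J v) = (j A v, i κ B v)`.
[cite: McDuffSalamon2017, Ex. 4.4.5] -/
theorem splitLine_J (hdim : finrank ℝ V = finrank ℝ W + 2) {n : V} (hn : n ∈ normalSpace a d)
    (hn0 : n ≠ 0) (v : V) :
    splitLine a d J j n (J v) =
      (j (splitLine a d J j n v).1, Complex.I * (splitLine a d J j n v).2) := by
  rw [splitLine_apply, splitLine_apply, splitF_J ha hnd hJ hJt hj, splitG_J ha hnd hJ hJt,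
    lineCoord_adaptedJ ha hnd hJt hdim hn hn0]

include ha hnd hJ hJt hjt in
/-- **The splitting map in a frame, `V → W × ℂ`, is bijective** (`dim V = dim W + 2`,
`0 ≠ n ∈ G`). [cite: McDuffSalamon2017, Ex. 4.4.5] -/
theorem splitLine_bijective (hdim : finrank ℝ V = finrank ℝ W + 2) {n : V} (hn : n ∈ normalSpace a d)
    (hn0 : n ≠ 0) : Bijective (splitLine a d J j n) := by
  refine ⟨(injective_iff_map_eq_zero _).2 fun v hv ↦ ?_, fun p ↦ ?_⟩
  · rw [splitLine_apply, Prod.mk_eq_zero] at hv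
    exact eq_zero_of_splitF_eq_zero_of_splitG_eq_zero ha hnd hJ hJt hjt hv.1
      (eq_zero_of_lineCoord_eq_zero ha hnd hJt hdim hn hn0 (splitG_mem_normalSpace hnd v) hv.2)
  · set g : V := p.2.re • n + p.2.im • adaptedJ a d J n with hg
    have hgmem : g ∈ normalSpace a d :=
      add_mem (Submodule.smul_mem _ _ hn) (Submodule.smul_mem _ _ (adaptedJ_mem_normalSpace ha hnd hJt hn))
    obtain ⟨v, hvF, hvG⟩ := exists_splitF_eq_splitG_eq ha hnd hJ hJt hjt p.1 hgmem
    refine ⟨v, ?_⟩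
    rw [splitLine_apply, hvF, hvG, hg, lineCoord_lincomb ha hnd hJt hn hn0]

end Split

end SymplecticSplitting

end Literature.Geometry.Symplectic

end
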